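import Summits.CriticalPhenomena.PercolationContinuityZ3.Theorems.PercShatteringRaceNearLinearTwoClusterDecayStubBootstrapInit
import HarnessLib

/-!
# Crux `PercRayRenewal.JumpLineAvoidanceDecay` (stmt-CriticalPhenomena-4626) — stub `stub_boxTwoArmsDecay`

Helper file of the line `registered` of the crux `JumpLineAvoidanceDecay`; lands with
`--supports stmt-CriticalPhenomena-4626` (registered stub `stub_boxTwoArmsDecay`).

## Statement

`stub_boxTwoArmsDecay` (UNCONDITIONAL, at the true `p_c(ℤ³)`, no jump hypothesis): there are an
integer `s ≥ 1`, an exponent `β > 0` and a constant `C` such that for every `r ≥ 1` the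
`P_{p_c}`-probability that two sites `u, v ∈ Λ(r)` are each joined inside `Λ(r^s)` to `∂Λ(r^s)` by
open paths but NOT to each other inside `Λ(r^s)` is at most `C · r^{−β}`.

## Proof

* The event is (contained in) the complement of the tree's uniqueness zone
  `uniqZone r (r^s)` (`Literature/Probability/Percolation/UniquenessZone.lean`): unfolding
  `uniqZone`, `toBdry`, `DCT16.BdryConn` it is literally its negation
  (`boxTwoArms_subset_compl_uniqZone`).
* Duminil-Copin–Kozma–Tassion 2020 Proposition 1 at `p = p_c(ℤ³)`, proved in the tree as
  `NearLinearTwoClusterDecayBootstrapInit.exists_real_compl_uniqZone_floor_le`: there are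
  `α ∈ (0,1)` and `n₁` with `P_{p_c}((uniqZone ⌊n^α⌋₊ n)ᶜ) ≤ n^{−α}` for all `n ≥ n₁`.
* Witnesses `s = ⌈2/α⌉₊` (so `s α ≥ 2`, `s ≥ 1`), `β = 2`, `C = max 1 (n₁^2)`. For `1 ≤ r < n₁` the
  probability is `≤ 1 ≤ n₁² r^{−2} ≤ C r^{−2}`. For `r ≥ n₁` put `n = r^s ≥ r ≥ n₁`; then
  `n^α = r^{sα} ≥ r`, so `r ≤ ⌊n^α⌋₊` and, `uniqZone` being antitone in the inner radius
  (`uniqZone_anti_left`), `P(event) ≤ P((uniqZone r n)ᶜ) ≤ P((uniqZone ⌊n^α⌋₊ n)ᶜ) ≤ n^{−α}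
  = r^{−sα} ≤ r^{−2} ≤ C r^{−2}`.

## References

* H. Duminil-Copin, G. Kozma, V. Tassion, *Upper bounds on the percolation correlation length*,
  in: *In and Out of Equilibrium 3: Celebrating Vladas Sidoravicius*, Progress in Probability 77,
  Birkhäuser 2021, arXiv:1902.03207, Proposition 1 [DuminilcopinKozmaTassion2020].
-/

noncomputable section

namespace Summit.CriticalPhenomena.PercolationContinuityZ3.Theorems

open MeasureTheory Literature.Probability.Percolation Literature.Probability.LatticeModels
open NearLinearTwoClusterDecayBootstrapInit

/-- **The box two-arms event lies in the complement of the uniqueness zone.** If two sites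
`u, v ∈ Λ(r)` are each joined inside `Λ(n)` to `∂Λ(n)` but not to each other inside `Λ(n)`, the
configuration is not in `uniqZone r n` (this is the definition of `uniqZone`, unfolded through
`toBdry` and `DCT16.BdryConn`). [folklore] -/
theorem boxTwoArms_subset_compl_uniqZone (r n : ℕ) :
    {ω | ∃ u ∈ box 3 r, ∃ v ∈ box 3 r,
        (∃ y ∈ innerBoundary (zdGraph 3) (box 3 n), ω ∈ openConnIn ↑(box 3 n) u y) ∧
        (∃ y ∈ innerBoundary (zdGraph 3) (box 3 n), ω ∈ openConnIn ↑(box 3 n) v y) ∧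
        ω ∉ openConnIn ↑(box 3 n) u v} ⊆ (uniqZone (d := 3) r n)ᶜ := by
  rintro ω ⟨u, hu, v, hv, hbu, hbv, huv⟩ hU
  exact huv (hU u hu v hv hbu hbv)

/-- **Stub `stub_boxTwoArmsDecay` — two-arms decay for boxes at `p_c(ℤ³)` (unconditional).**
There are an integer `s ≥ 1`, an exponent `β > 0` and a constant `C` such that for every `r ≥ 1`
the probability, at `p_c(ℤ³)`, that two sites of `Λ(r)` are joined inside `Λ(r^s)` to `∂Λ(r^s)`
by open paths but not to each other inside `Λ(r^s)` is at most `C · r^{−β}`. Obtained from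
Duminil-Copin–Kozma–Tassion 2020 Proposition 1 at `p = p_c` (`exists_real_compl_uniqZone_floor_le`)
with `s = ⌈2/α⌉₊`, `β = 2`, `C = max 1 (n₁^2)`: the event is contained in `(uniqZone r (r^s))ᶜ`,
and `uniqZone` is antitone in the inner radius. [cite: DuminilcopinKozmaTassion2020, Prop 1] -/
theorem stub_boxTwoArmsDecay :
    ∃ s : ℕ, ∃ β C : ℝ, 1 ≤ s ∧ 0 < β ∧ ∀ r : ℕ, 1 ≤ r →
      (bondPercolation (zdGraph 3) (criticalProbI 3)).real
        {ω | ∃ u ∈ box 3 r, ∃ v ∈ box 3 r,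
          (∃ y ∈ innerBoundary (zdGraph 3) (box 3 (r ^ s)), ω ∈ openConnIn ↑(box 3 (r ^ s)) u y) ∧
          (∃ y ∈ innerBoundary (zdGraph 3) (box 3 (r ^ s)), ω ∈ openConnIn ↑(box 3 (r ^ s)) v y) ∧
          ω ∉ openConnIn ↑(box 3 (r ^ s)) u v} ≤ C * (r : ℝ) ^ (-β) := by
  obtain ⟨α, hα0, _hα1, n₁, hn₁⟩ := exists_real_compl_uniqZone_floor_le
  -- the aspect exponent `s = ⌈2/α⌉₊`, so that `s * α ≥ 2` and `s ≥ 1`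
  have h2α : (0 : ℝ) < 2 / α := div_pos two_pos hα0
  have hsα : (2 : ℝ) ≤ (⌈2 / α⌉₊ : ℝ) * α := by
    calc (2 : ℝ) = 2 / α * α := (div_mul_cancel₀ _ hα0.ne').symm
      _ ≤ (⌈2 / α⌉₊ : ℝ) * α := mul_le_mul_of_nonneg_right (Nat.le_ceil _) hα0.le
  have hs1 : 1 ≤ ⌈2 / α⌉₊ := Nat.ceil_pos.2 h2α
  refine ⟨⌈2 / α⌉₊, 2, max 1 ((n₁ : ℝ) ^ (2 : ℝ)), hs1, two_pos, fun r hr => ?_⟩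
  have hr1 : (1 : ℝ) ≤ r := by exact_mod_cast hr
  have hrpos : (0 : ℝ) < r := zero_lt_one.trans_le hr1
  have hr0 : (0 : ℝ) ≤ r := hrpos.le
  have hrβ0 : (0 : ℝ) ≤ (r : ℝ) ^ (-(2 : ℝ)) := Real.rpow_nonneg hr0 _
  rcases lt_or_ge r n₁ with hrn | hrn
  · -- small `r < n₁`: the probability is at most `1 ≤ n₁² · r⁻² ≤ C · r⁻²`
    have h1 : (r : ℝ) ^ (2 : ℝ) ≤ (n₁ : ℝ) ^ (2 : ℝ) :=
      Real.rpow_le_rpow hr0 (by exact_mod_cast hrn.le) (by norm_num)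
    have h2 : (r : ℝ) ^ (2 : ℝ) * (r : ℝ) ^ (-(2 : ℝ)) = 1 := by
      rw [← Real.rpow_add hrpos, add_neg_cancel, Real.rpow_zero]
    calc (bondPercolation (zdGraph 3) (criticalProbI 3)).real _ ≤ 1 := measureReal_le_one
      _ = (r : ℝ) ^ (2 : ℝ) * (r : ℝ) ^ (-(2 : ℝ)) := h2.symm
      _ ≤ (n₁ : ℝ) ^ (2 : ℝ) * (r : ℝ) ^ (-(2 : ℝ)) := mul_le_mul_of_nonneg_right h1 hrβ0
      _ ≤ max 1 ((n₁ : ℝ) ^ (2 : ℝ)) * (r : ℝ) ^ (-(2 : ℝ)) :=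
        mul_le_mul_of_nonneg_right (le_max_right _ _) hrβ0
  · -- large `r ≥ n₁`: the outer radius `n = r^s ≥ r ≥ n₁`
    have hs0 : ⌈2 / α⌉₊ ≠ 0 := Nat.one_le_iff_ne_zero.1 hs1
    have hrn' : r ≤ r ^ ⌈2 / α⌉₊ := Nat.le_self_pow hs0 r
    have hn₁n : n₁ ≤ r ^ ⌈2 / α⌉₊ := hrn.trans hrn'
    have hncast : ((r ^ ⌈2 / α⌉₊ : ℕ) : ℝ) = (r : ℝ) ^ ((⌈2 / α⌉₊ : ℕ) : ℝ) := by
      rw [Nat.cast_pow, Real.rpow_natCast]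
    -- `r ≤ ⌊n^α⌋₊` since `n^α = r^{sα} ≥ r`
    have hrfl : r ≤ ⌊((r ^ ⌈2 / α⌉₊ : ℕ) : ℝ) ^ α⌋₊ := by
      refine Nat.le_floor ?_
      calc (r : ℝ) = (r : ℝ) ^ (1 : ℝ) := (Real.rpow_one _).symm
        _ ≤ (r : ℝ) ^ (((⌈2 / α⌉₊ : ℕ) : ℝ) * α) :=
          Real.rpow_le_rpow_of_exponent_le hr1 (by linarith)
        _ = ((r ^ ⌈2 / α⌉₊ : ℕ) : ℝ) ^ α := by rw [Real.rpow_mul hr0, hncast]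
    -- the event lies in `(uniqZone r n)ᶜ ⊆ (uniqZone ⌊n^α⌋₊ n)ᶜ` (antitone in the inner radius)
    have hincl :
        {ω | ∃ u ∈ box 3 r, ∃ v ∈ box 3 r,
          (∃ y ∈ innerBoundary (zdGraph 3) (box 3 (r ^ ⌈2 / α⌉₊)),
              ω ∈ openConnIn ↑(box 3 (r ^ ⌈2 / α⌉₊)) u y) ∧
          (∃ y ∈ innerBoundary (zdGraph 3) (box 3 (r ^ ⌈2 / α⌉₊)),
              ω ∈ openConnIn ↑(box 3 (r ^ ⌈2 / α⌉₊)) v y) ∧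
          ω ∉ openConnIn ↑(box 3 (r ^ ⌈2 / α⌉₊)) u v} ⊆
          (uniqZone (d := 3) ⌊((r ^ ⌈2 / α⌉₊ : ℕ) : ℝ) ^ α⌋₊ (r ^ ⌈2 / α⌉₊))ᶜ :=
      (boxTwoArms_subset_compl_uniqZone r (r ^ ⌈2 / α⌉₊)).trans
        (Set.compl_subset_compl.2 (uniqZone_anti_left hrfl _))
    calc (bondPercolation (zdGraph 3) (criticalProbI 3)).real _
          ≤ (bondPercolation (zdGraph 3) (criticalProbI 3)).real
              (uniqZone (d := 3) ⌊((r ^ ⌈2 / α⌉₊ : ℕ) : ℝ) ^ α⌋₊ (r ^ ⌈2 / α⌉₊))ᶜ :=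
          measureReal_mono hincl (measure_ne_top _ _)
      _ ≤ ((r ^ ⌈2 / α⌉₊ : ℕ) : ℝ) ^ (-α) := hn₁ _ hn₁n
      _ = (r : ℝ) ^ (-(((⌈2 / α⌉₊ : ℕ) : ℝ) * α)) := by
          rw [hncast, ← Real.rpow_mul hr0, mul_neg]
      _ ≤ (r : ℝ) ^ (-(2 : ℝ)) := Real.rpow_le_rpow_of_exponent_le hr1 (by linarith)
      _ = 1 * (r : ℝ) ^ (-(2 : ℝ)) := (one_mul _).symm
      _ ≤ max 1 ((n₁ : ℝ) ^ (2 : ℝ)) * (r : ℝ) ^ (-(2 : ℝ)) :=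
          mul_le_mul_of_nonneg_right (le_max_left _ _) hrβ0

end Summit.CriticalPhenomena.PercolationContinuityZ3.Theorems

end
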